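import Mathlib
import HarnessLib
import Literature.MathematicalPhysics.StatisticalMechanics.WeightIntegrationABKM
import Literature.MathematicalPhysics.QuantumFieldTheory.GaussianQuadraticIntegrable

/-!
# (w7) and integrability of the torus weights against the step measure on FIELD SPACE
# (Adams–Buchholz–Kotecký–Müller, Theorem 7.1 (w7) / Lemma 8.4 hypotheses `hw`, `hwint`)

`WeightIntegrationABKM.integral_weight_abkm_le` states (w7) as an integral over Mathlib's
`multivariateGaussian 0 (circulant 𝒞_{k+1})` on Euclidean space; the Chapter-8 estimates
(`WeightedNormBounds.TayNormLE.integral_comp_add`, `…DominationSection.integral_comp_add_section`)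
take a measure `μ` on the field space `Λ → ℝ` and the hypotheses
`∀ φ, ∫ ξ, w(φ+ξ) ∂μ ≤ A · w'(φ)` and `∀ φ, Integrable (w(φ + ·)) μ`.  This file provides both for
`μ_{k+1} := (multivariateGaussian 0 (circulant 𝒞_{k+1})).map ofLp`:

* `stepMeasure` and `integral_stepMeasure_comp_add` (change of variables);
* `integrable_weight_abkm` (from `form_subcritical`, `cov k − circulant ⪰ 0` and
  `GaussianQuadraticIntegrable`);
* **`integral_weight_abkm_le_map`** — (w7) in the field-space form.

Everything is proved; no named fact.

## References
* S. Adams, S. Buchholz, R. Kotecký, S. Müller, arXiv:1910.13564, Theorem 7.1 (w7), Lemma 8.4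
  [AdamsBuchholzKoteckyMuller2019].
-/

noncomputable section

namespace Literature.MathematicalPhysics.StatisticalMechanics.GradientRG

open Finset Matrix Real MeasureTheory ProbabilityTheory WithLp
open scoped MatrixOrder
open Literature.MathematicalPhysics.StatisticalMechanics.GradientFRD
  (iterDiff mulMat fourierCoeff cExt posSemidef_mulMat posSemidef_mulMat_sub)
open Literature.MathematicalPhysics.StatisticalMechanics.TorusPolymer (IsPolymer numBlocks)
open Literature.MathematicalPhysics.QuantumFieldTheory (integrable_exp_half_quadForm_shift_multivariateGaussian)

variable {d M : ℕ} [NeZero M]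

/-- The step measure `μ_{k+1} = N(0, circulant 𝒞_{k+1})` on field space `Λ → ℝ`.
[cite: AdamsBuchholzKoteckyMuller2019, Ch. 4 (4.2)] -/
def stepMeasure (𝒞 : (Fin d → ZMod M) → ℝ) : Measure ((Fin d → ZMod M) → ℝ) :=
  (multivariateGaussian 0 (Matrix.circulant 𝒞)).map (ofLp : EuclideanSpace ℝ (Fin d → ZMod M) → _)

/-- Change of variables for the step measure. [cite: AdamsBuchholzKoteckyMuller2019, Ch. 4 (4.2)] -/
theorem integral_stepMeasure {𝒞 : (Fin d → ZMod M) → ℝ} {F : ((Fin d → ZMod M) → ℝ) → ℝ}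
    (hF : Continuous F) :
    ∫ ξ, F ξ ∂(stepMeasure 𝒞) = ∫ ψ, F (ofLp ψ) ∂(multivariateGaussian 0 (Matrix.circulant 𝒞)) := by
  rw [stepMeasure, integral_map (PiLp.continuous_ofLp 2 _).measurable.aemeasurable hF.aestronglyMeasurable]

/-- The weights are continuous in the field. [cite: AdamsBuchholzKoteckyMuller2019, Ch. 7.1 (7.4)] -/
theorem continuous_weight_comp_add (W : WeightData (Fin d → ZMod M)) (k : ℕ) (X : Finset (Fin d → ZMod M))
    (φ : (Fin d → ZMod M) → ℝ) : Continuous fun ξ : (Fin d → ZMod M) → ℝ => W.weight k X (φ + ξ) := by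
  unfold WeightData.weight
  exact Real.continuous_exp.comp (continuous_const.mul ((continuous_const.add continuous_id).dotProduct
    (continuous_const.matrix_mulVec (continuous_const.add continuous_id))))

/-- **`w_k^X(φ + ·)` is `μ_{k+1}`-integrable** for dominated weight data whose step covariance dominates
the step measure's (`cov k − circulant 𝒞_{k+1} ⪰ 0`). [cite: AdamsBuchholzKoteckyMuller2019, Lemma 8.4] -/
theorem integrable_weight_of_dominated (W : WeightData (Fin d → ZMod M)) {D : ℕ → Matrix _ _ ℝ}
    (hD : W.Dominated D) {k : ℕ} {𝒞 : (Fin d → ZMod M) → ℝ} (hC : (Matrix.circulant 𝒞).PosSemidef)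
    (hle : (W.cov k - Matrix.circulant 𝒞).PosSemidef) (X : Finset (Fin d → ZMod M))
    (φ : (Fin d → ZMod M) → ℝ) :
    Integrable (fun ξ : (Fin d → ZMod M) → ℝ => W.weight k X (φ + ξ)) (stepMeasure 𝒞) := by
  rw [stepMeasure, integrable_map_measure (continuous_weight_comp_add W k X φ).aestronglyMeasurable
    (PiLp.continuous_ofLp 2 _).measurable.aemeasurable]
  have hsub := posDef_one_sub_sqrt_mul_sqrt_anti_cov (WeightData.form_posSemidef hD k X) hC hle
    (WeightData.form_subcritical hD k X)
  exact integrable_exp_half_quadForm_shift_multivariateGaussian _ (WeightData.form_isSymm hD k X) hsub φ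

/-- **Theorem 7.1 (w7) on field space** for the torus weight data (hypotheses as in
`integral_weight_abkm_le`): `∫ ξ, w_k^X(φ + ξ) ∂μ_{k+1} ≤ weightIntConst^{|X|_k} · w_{k:k+1}^X(φ)`.
[cite: AdamsBuchholzKoteckyMuller2019, Theorem 7.1 (w7)] -/
theorem integral_weight_abkm_le_map {L N Mord R : ℕ} (hd : 2 ≤ d) (hMord : 1 ≤ Mord) (hMR : Mord ≤ R)
    (hLodd : Odd L) (hL : 2 ^ (d + 3) + 16 * R ≤ L) {θbar : ℝ} (hθbar : 0 < θbar) {δ' : ℕ → ℝ}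
    {𝒞 : ℕ → (Fin d → ZMod M) → ℝ} {lam : ℝ} (hlam : 0 < lam) {θ : ℕ → ℝ}
    (hθlo : ∀ k, θbar ≤ θ k)
    (hnn : ∀ (j : ℕ) (κ : Fin d → ZMod M), 0 ≤ cExt N (fun j => fourierCoeff (𝒞 j) κ) j)
    (hf_zero : ∀ j : ℕ, cExt N (fun j => fourierCoeff (𝒞 j) (0 : Fin d → ZMod M)) j = 0)
    (hf_even : ∀ (κ : Fin d → ZMod M) (j : ℕ), cExt N (fun j => fourierCoeff (𝒞 j) (-κ)) j =
      cExt N (fun j => fourierCoeff (𝒞 j) κ) j)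
    (hD : (abkmWeightData L N Mord R θbar δ' 𝒞).Dominated fun k =>
      mulMat (domMul lam θ (fun k => derivMul (L : ℝ) k (diffIndex d Mord))
        (tailMul N fun κ j => fourierCoeff (𝒞 j) κ) k))
    {k : ℕ} (hk : k + 1 ≤ N + 1) (heven : ∀ x, 𝒞 (k + 1) (-x) = 𝒞 (k + 1) x)
    {n : ℕ} (hn : 2 * Mord ≤ n) {Cα : (Fin d → ℕ) → ℕ → ℝ}
    (hreg : ∀ θ' : Fin d → ℕ, ∑ i, θ' i ≤ n → ∀ x,
      |iterDiff θ' (𝒞 (k + 1)) x| ≤ Cα θ' 0 / (L : ℝ) ^ ((k + 1 - 1) * (d - 2 + ∑ i, θ' i)))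
    {X : Finset (Fin d → ZMod M)} (hX : IsPolymer (L ^ k) X) (φ : (Fin d → ZMod M) → ℝ) :
    ∫ ξ, (abkmWeightData L N Mord R θbar δ' 𝒞).weight k X (φ + ξ) ∂(stepMeasure (𝒞 (k + 1))) ≤
      weightIntConst θbar (traceConst d Mord R lam (derivSum d n Cα)) ^ numBlocks (L ^ k) X *
        (abkmWeightData L N Mord R θbar δ' 𝒞).midWeight k X φ := by
  rw [integral_stepMeasure (continuous_weight_comp_add _ k X φ)]
  exact integral_weight_abkm_le hd hMord hMR hLodd hL hθbar hlam hθlo hnn hf_zero hf_even hD hk heven hn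
    hreg hX φ

/-- **Integrability of `w_k^X(φ + ·)` against `μ_{k+1}`** for the torus weight data (`θ̄ ≥ 0`).
[cite: AdamsBuchholzKoteckyMuller2019, Lemma 8.4] -/
theorem integrable_weight_abkm {L N Mord R : ℕ} {θbar : ℝ} (hθbar : 0 ≤ θbar) {δ' : ℕ → ℝ}
    {𝒞 : ℕ → (Fin d → ZMod M) → ℝ} {D : ℕ → Matrix (Fin d → ZMod M) (Fin d → ZMod M) ℝ}
    (hD : (abkmWeightData L N Mord R θbar δ' 𝒞).Dominated D)
    (hnn : ∀ (j : ℕ) (κ : Fin d → ZMod M), 0 ≤ cExt N (fun j => fourierCoeff (𝒞 j) κ) j)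
    {k : ℕ} (hk : k + 1 ≤ N + 1) (heven : ∀ x, 𝒞 (k + 1) (-x) = 𝒞 (k + 1) x)
    (X : Finset (Fin d → ZMod M)) (φ : (Fin d → ZMod M) → ℝ) :
    Integrable (fun ξ : (Fin d → ZMod M) → ℝ => (abkmWeightData L N Mord R θbar δ' 𝒞).weight k X (φ + ξ))
      (stepMeasure (𝒞 (k + 1))) := by
  have hCeq := circulant_eq_mulMat_cExt hk heven (N := N)
  refine integrable_weight_of_dominated _ hD ?_ ?_ X φ
  · rw [hCeq]; exact posSemidef_mulMat fun κ => hnn (k + 1) κ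
  · rw [hCeq, abkmWeightData, geomWeightData_cov]
    exact posSemidef_mulMat_sub fun κ => by nlinarith [hnn (k + 1) κ]

end Literature.MathematicalPhysics.StatisticalMechanics.GradientRG

end
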